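import Mathlib.Analysis.SpecialFunctions.Pow.NNReal
import Mathlib.Topology.Algebra.InfiniteSum.ENNReal
import HarnessLib

/-!
# Rényi power sum of dependent pairs on countable carriers ([HPRR20, Prop. 4] = [FGdGJK26] App. A Lemma 16, N = 2)

Topic `Probability/Divergences`; namespace `Literature.Probability.Divergences`. PROVED, no definition, no named fact.
PRINTED STATEMENT ([FGdGJK26] App. A Lemma 16 «[HPRR20, Prop. 4]», HAL hal-05635650v1 p0028 L15–L26): for `N`-tuples of
random variables with `R_a(P_i | x_{<i} ‖ Q_i | x_{<i}) ≤ r_{a,i}` for every prefix in the support,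
«`R_a(P‖Q) ≤ Π_i r_{a,i}`». Here the STEP `N = 2` (a marginal times a kernel) in the crypto convention's `(a−1)`-th power on
ARBITRARY index types with `ℝ≥0∞` weights and `tsum`s (so countable PMF carriers are covered; the finite twin is
`RenyiFinite.renyiSumFin_kernel_le`); the `N`-tuple bound is this step iterated, exactly as in print.

* `tsum_prod_kernel_rpow_le` — `Σ'_{(x,y)} (P₁(x)K_P(x,y))^a (Q₁(x)K_Q(x,y))^{1−a} ≤ ρ · Σ'_x P₁(x)^a Q₁(x)^{1−a}` when every
  conditional power sum over `x ∈ Supp(P₁)` is `≤ ρ` (`ρ = r^{a−1}`), `a > 0`, finite `Q`-weights.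
-/

noncomputable section

open scoped ENNReal

namespace Literature.Probability.Divergences

variable {α β : Type*}

/-- Pointwise splitting of the joint summand: `(P₁ K_P)^a (Q₁ K_Q)^{1−a} = (P₁^a Q₁^{1−a})·(K_P^a K_Q^{1−a})` (`a ≥ 0`, finite
`Q₁`, `K_Q` weights). [cite: FouqueEtAl2026CloserLookFalcon, App. A Lemma 16 (= [HPRR20, Prop. 4]), proof step; elementary/ours] -/
theorem joint_rpow_mul_rpow_eq {P₁ Q₁ KP KQ : ℝ≥0∞} {a : ℝ} (ha : 0 ≤ a) (hQ : Q₁ ≠ ⊤) (hK : KQ ≠ ⊤) :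
    (P₁ * KP) ^ a * (Q₁ * KQ) ^ (1 - a) = (P₁ ^ a * Q₁ ^ (1 - a)) * (KP ^ a * KQ ^ (1 - a)) := by
  rw [ENNReal.mul_rpow_of_nonneg _ _ ha, ENNReal.mul_rpow_of_ne_top hQ hK]
  ring

/-- **Dependent pairs (Lemma 16, step `N = 2`) on countable carriers**: if for every `x` with `P₁ x ≠ 0` the conditional
power sum satisfies `Σ'_y K_P(x,y)^a K_Q(x,y)^{1−a} ≤ ρ`, then
`Σ'_{(x,y)} (P₁(x)K_P(x,y))^a (Q₁(x)K_Q(x,y))^{1−a} ≤ ρ · Σ'_x P₁(x)^a Q₁(x)^{1−a}` — i.e. `R_a(P‖Q) ≤ R_a(P₁‖Q₁)·r` with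
`ρ = r^{a−1}` after the monotone `1/(a−1)`-th power (`a > 1`). Weights in `ℝ≥0∞` (e.g. PMF values), `Q₁`, `K_Q` finite
pointwise, `a > 0`. [cite: FouqueEtAl2026CloserLookFalcon, App. A Lemma 16 (= [HPRR20, Prop. 4]) (p. 27; render p0028 L15–L26)] -/
theorem tsum_prod_kernel_rpow_le (P₁ Q₁ : α → ℝ≥0∞) (KP KQ : α → β → ℝ≥0∞) {a : ℝ} (ha : 0 < a) (ρ : ℝ≥0∞)
    (hQ : ∀ x, Q₁ x ≠ ⊤) (hKQ : ∀ x y, KQ x y ≠ ⊤)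
    (hK : ∀ x, P₁ x ≠ 0 → ∑' y, KP x y ^ a * KQ x y ^ (1 - a) ≤ ρ) :
    ∑' xy : α × β, (P₁ xy.1 * KP xy.1 xy.2) ^ a * (Q₁ xy.1 * KQ xy.1 xy.2) ^ (1 - a)
      ≤ ρ * ∑' x, P₁ x ^ a * Q₁ x ^ (1 - a) := by
  have hsplit : (fun xy : α × β => (P₁ xy.1 * KP xy.1 xy.2) ^ a * (Q₁ xy.1 * KQ xy.1 xy.2) ^ (1 - a))
      = fun xy : α × β => (P₁ xy.1 ^ a * Q₁ xy.1 ^ (1 - a)) * (KP xy.1 xy.2 ^ a * KQ xy.1 xy.2 ^ (1 - a)) := by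
    funext xy
    exact joint_rpow_mul_rpow_eq ha.le (hQ xy.1) (hKQ xy.1 xy.2)
  rw [hsplit]
  set F : α → β → ℝ≥0∞ := fun x y => (P₁ x ^ a * Q₁ x ^ (1 - a)) * (KP x y ^ a * KQ x y ^ (1 - a)) with hF
  have hprod : ∑' xy : α × β, F xy.1 xy.2 = ∑' x, ∑' y, F x y := ENNReal.tsum_prod
  change ∑' xy : α × β, F xy.1 xy.2 ≤ _
  rw [hprod]
  simp only [hF]
  simp_rw [ENNReal.tsum_mul_left]
  -- per `x`: `c_x · S_x ≤ c_x · ρ` (trivial when `P₁ x = 0`, since then `c_x = 0`)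
  have hx : ∀ x, (P₁ x ^ a * Q₁ x ^ (1 - a)) * ∑' y, KP x y ^ a * KQ x y ^ (1 - a)
      ≤ (P₁ x ^ a * Q₁ x ^ (1 - a)) * ρ := by
    intro x
    by_cases hP : P₁ x = 0
    · rw [hP, ENNReal.zero_rpow_of_pos ha, zero_mul, zero_mul, zero_mul]
    · exact mul_le_mul' le_rfl (hK x hP)
  calc ∑' x, (P₁ x ^ a * Q₁ x ^ (1 - a)) * ∑' y, KP x y ^ a * KQ x y ^ (1 - a)
      ≤ ∑' x, (P₁ x ^ a * Q₁ x ^ (1 - a)) * ρ := ENNReal.tsum_le_tsum hx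
    _ = ρ * ∑' x, P₁ x ^ a * Q₁ x ^ (1 - a) := by rw [ENNReal.tsum_mul_right, mul_comm]

end Literature.Probability.Divergences

end
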